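import Mathlib
import Summits.CriticalPhenomena.PercolationContinuityZ3.Theorems.PercNearOneGluingNoHeavyQuantSecondWeightLevels
import HarnessLib

/-!
# QUANT lane R8, front "FAR beyond trees" — the BOOSTED chain lemma: a distinguished relay with an independent second route

builds on p205010 (kernel theorem, internal audit signed; external expert review pending)

Support file (`--supports stmt-CriticalPhenomena-4575`), seat `prim-quant-p1` (gen 15); memo
`run/shared/lean/prim/quant/prim-quant-p1-g15/FOR-LEAD-TWOCHAIN.md` §3.  Continues the list algebra of
`…QuantSecondWeightOdds.lean` / `…Singles.lean` / `…Levels.lean` (same local notations: items `(w, p)`, `EFS[L, x] = (E W, E F)`,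
`σS`, `Adm`).  Pure real algebra on lists; no definitions, no sorries, standard axioms.

**Setting.**  In the layer-one multi-companion inequality on a caterpillar (the chain lemma, `secondWeight_singles`:
`E W ≥ x·min(1, Σ w p)`), the distinguished relay `a` sits at the bottom of the chain and the value of the configuration
"exactly one companion occurs" is `x = P(o ↔ a)`.  On a support WITH A CYCLE through the observer the distinguished relay has a
SECOND ROUTE.  The simplest law-level shape (the `a_k = 0` vertex of the one-sided two-chain system of the memo, §3–§4): `a` is
joined to `o` through the chain with probability `y` AND through an independent route ("boost") of probability `b`, so that its
marginal is `x = y + b(1 − y)`; the companions are admissible at level `x` (`x ≤ w p`).  Conditioning on the boost,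
`P(N ≥ 2) = (1 − b)·E W_y + b·E F₀`, where `E W_y = (EFS[L, y]).1` (second weight with single-occurrence value `y`) and
`E F₀ = (EFS[L, 0]).2` (first occurring weight, `0` if none: with the boost open, `a` is reached and one reached companion suffices).

* `EFS_affine_base` — `y ↦ EFS[L, y]` is affine: `EFS[L, y] = ((EFS[L,0]).1 + y·S, (EFS[L,0]).2 + y·Z)` with `S, Z ≥ 0`
  (`S = P(exactly one item occurs)`, `Z = P(none occurs)`).
* `EFS_fst_le_snd`, `efs_snd_le_of_weights_le`, `efs_one_le_sigma`, `sigma_le_efs`, `length_mul_le_sigma` — for items listed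
  HEAVIEST FIRST: `E W₀ ≤ E F₀`, `E F₀ − E W₀ ≤ Σ w p ≤ E F₀ + (|L| − 1)·E W₀`, `|L|·x ≤ Σ w p` (the moment sandwich of the
  one-level count: `P(C = 1) ≤ E C ≤ P(C = 1) + n·P(C ≥ 2)`, `n x ≤ E C`).
* `Quant.SecondWeight.boost_base` — **the independent-relay case** (`y = 0`): `(1 − x)·E W₀ + x·E F₀ ≥ x·min(1, Σ w p)`
  (one admissible level in `level_reduce`).
* `Quant.SecondWeight.secondWeight_boost` — **THE BOOSTED CHAIN LEMMA**: for items admissible at `x > 0`, heaviest first, and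
  `0 ≤ y ≤ x`:  `(1 − y)·x·min(1, Σ w p) ≤ (1 − x)·(EFS[L, y]).1 + (x − y)·(EFS[L, 0]).2`, i.e. with `b = (x − y)/(1 − y)`:
  `(1 − b) E W_y + b E F₀ ≥ x·min(1, σ)`.  Proof: the defect is affine in `y`; the endpoint `y = x` is `secondWeight_singles`,
  the endpoint `y = 0` is `boost_base`.
At `b = 0` this is the chain lemma; it is the first law-level inequality of the layer-one programme in which the distinguished
relay is reached along two routes.  Exact numerical re-check: `prim-quant-p1-g15/num/boost_check.py` (2·10⁵ random admissible
instances, sorted and unsorted, 0 violations).  Nearest prior art searched (corpus hybrid "lower bound probability at least two successes dependent events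
union of two monotone chains", vsearch "expected weight of the second item to occur … lower bound x·min(1, Σ w p)", galaxy
"second order statistic|Poisson binomial|prophet inequalit", 2026-08-21): nothing related; [this work].
-/

namespace Summit.CriticalPhenomena.PercolationContinuityZ3.Theorems

namespace Quant

namespace SecondWeight

open Finset

/-- `zS[L] = ∏_{(w,p) ∈ L} (1 − p)`: no item occurs. -/
local notation3 "zS[" L "]" => (List.foldr (fun (l : ℝ × ℝ) (acc : ℝ) => (1 - l.2) * acc) (1 : ℝ) L)
/-- `EFS[L, x] = (E W, E F)`: expected second occurring weight (`x` if exactly one, `0` if none) and expected first occurring weight (`x` if none). -/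
local notation3 "EFS[" L ", " x "]" =>
  (List.foldr (fun (l : ℝ × ℝ) (acc : ℝ × ℝ) => (l.2 * acc.2 + (1 - l.2) * acc.1, l.1 * l.2 + (1 - l.2) * acc.2)) ((0 : ℝ), (x : ℝ)) L)
/-- `σS[L] = Σ w p`: expected total occurring weight. -/
local notation3 "σS[" L "]" => (List.sum (List.map (fun (l : ℝ × ℝ) => l.1 * l.2) L))
/-- admissible item at level `x`: `0 ≤ p ≤ 1`, `w ≤ 1`, `x ≤ w p`. -/
local notation3 "Adm[" x ", " l "]" => (0 ≤ (l : ℝ × ℝ).2 ∧ (l : ℝ × ℝ).2 ≤ 1 ∧ (l : ℝ × ℝ).1 ≤ 1 ∧ (x : ℝ) ≤ (l : ℝ × ℝ).1 * (l : ℝ × ℝ).2)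

variable {x : ℝ}

/-! ### `EFS[L, y]` is affine in the base value `y` -/

/-- **Affinity in the base.**  `EFS[L, y] = ((EFS[L,0]).1 + y·S, (EFS[L,0]).2 + y·Z)` for some `S, Z ≥ 0`
(`S = P(exactly one occurs)`, `Z = P(none occurs)`), for probabilities in `[0, 1]`. [this work] -/
theorem EFS_affine_base (L : List (ℝ × ℝ)) (hL : ∀ l ∈ L, 0 ≤ l.2 ∧ l.2 ≤ 1) :
    ∃ S Z : ℝ, 0 ≤ S ∧ 0 ≤ Z ∧ ∀ y : ℝ, EFS[L, y] = ((EFS[L, 0]).1 + y * S, (EFS[L, 0]).2 + y * Z) := by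
  induction L with
  | nil => exact ⟨0, 1, le_refl _, zero_le_one, fun y => by simp⟩
  | cons l L ih =>
    have hl := hL l (by simp)
    obtain ⟨S, Z, hS, hZ, h⟩ := ih (fun l' hl' => hL l' (by simp [hl']))
    refine ⟨l.2 * Z + (1 - l.2) * S, (1 - l.2) * Z, ?_, ?_, fun y => ?_⟩
    · have h1 : 0 ≤ l.2 * Z := mul_nonneg hl.1 hZ
      have h2 : 0 ≤ (1 - l.2) * S := mul_nonneg (by linarith [hl.2]) hS
      linarith
    · exact mul_nonneg (by linarith [hl.2]) hZ
    · rw [EFS_cons, EFS_cons, h y, h 0]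
      ext <;> simp only <;> ring

/-! ### The one-level moment sandwich for items listed heaviest first -/

/-- `E F₀ ≤ c` when every weight is `≤ c` (and `0 ≤ c`, probabilities in `[0,1]`). [this work] -/
theorem efs_snd_le_of_weights_le (L : List (ℝ × ℝ)) {c : ℝ} (hc : 0 ≤ c) (hL : ∀ l ∈ L, 0 ≤ l.2 ∧ l.2 ≤ 1 ∧ l.1 ≤ c) :
    (EFS[L, 0]).2 ≤ c := by
  induction L with
  | nil => simpa using hc
  | cons l L ih =>
    have hl := hL l (by simp)
    have ih' := ih (fun l' hl' => hL l' (by simp [hl']))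
    rw [EFS_cons]
    show l.1 * l.2 + (1 - l.2) * (EFS[L, 0]).2 ≤ c
    nlinarith [hl.1, hl.2.1, hl.2.2]

/-- `E W₀ ≤ E F₀` for items listed heaviest first (probabilities in `[0,1]`, weights `≥ 0`). [this work] -/
theorem EFS_fst_le_snd (L : List (ℝ × ℝ)) (hL : ∀ l ∈ L, 0 ≤ l.2 ∧ l.2 ≤ 1 ∧ 0 ≤ l.1)
    (hsort : (List.map (fun l : ℝ × ℝ => l.1) L).Pairwise (fun u v => v ≤ u)) :
    (EFS[L, 0]).1 ≤ (EFS[L, 0]).2 := by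
  induction L with
  | nil => simp
  | cons l L ih =>
    have hl := hL l (by simp)
    have hL' : ∀ l' ∈ L, 0 ≤ l'.2 ∧ l'.2 ≤ 1 ∧ 0 ≤ l'.1 := fun l' hl' => hL l' (by simp [hl'])
    rw [List.map_cons, List.pairwise_cons] at hsort
    have ih' := ih hL' hsort.2
    have hFw : (EFS[L, 0]).2 ≤ l.1 := by
      refine efs_snd_le_of_weights_le L hl.2.2 (fun l' hl' => ⟨(hL' l' hl').1, (hL' l' hl').2.1, ?_⟩)
      exact hsort.1 l'.1 (List.mem_map.2 ⟨l', hl', rfl⟩)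
    rw [EFS_cons]
    show l.2 * (EFS[L, 0]).2 + (1 - l.2) * (EFS[L, 0]).1 ≤ l.1 * l.2 + (1 - l.2) * (EFS[L, 0]).2
    nlinarith [hl.1, hl.2.1]

/-- `E F₀ − E W₀ ≤ Σ w p` (`P(C = 1) ≤ E C`), probabilities in `[0,1]`, weights `≥ 0`. [this work] -/
theorem efs_one_le_sigma (L : List (ℝ × ℝ)) (hL : ∀ l ∈ L, 0 ≤ l.2 ∧ l.2 ≤ 1 ∧ 0 ≤ l.1) :
    (EFS[L, 0]).2 - (EFS[L, 0]).1 ≤ σS[L] := by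
  induction L with
  | nil => simp
  | cons l L ih =>
    have hl := hL l (by simp)
    have hL' : ∀ l' ∈ L, 0 ≤ l'.2 ∧ l'.2 ≤ 1 ∧ 0 ≤ l'.1 := fun l' hl' => hL l' (by simp [hl'])
    have ih' := ih hL'
    have hF0 : 0 ≤ (EFS[L, 0]).2 := (EFS_lower (le_refl (0 : ℝ)) L (fun l' hl' => ⟨(hL' l' hl').1, (hL' l' hl').2.1, (hL' l' hl').2.2⟩)).2
    have hσ : 0 ≤ σS[L] := σS_nonneg L (fun l' hl' => ⟨(hL' l' hl').1, mul_nonneg (hL' l' hl').2.2 (hL' l' hl').1⟩)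
    rw [EFS_cons, σS_cons]
    show l.1 * l.2 + (1 - l.2) * (EFS[L, 0]).2 - (l.2 * (EFS[L, 0]).2 + (1 - l.2) * (EFS[L, 0]).1) ≤ l.1 * l.2 + σS[L]
    nlinarith [hl.1, hl.2.1]

/-- `Σ w p ≤ E F₀ + (|L| − 1)·E W₀` (`E C ≤ P(C ≥ 1) + (n − 1)·P(C ≥ 2)`) for items listed heaviest first with weights in `[0, 1]`. [this work] -/
theorem sigma_le_efs (L : List (ℝ × ℝ)) (hL : ∀ l ∈ L, 0 ≤ l.2 ∧ l.2 ≤ 1 ∧ 0 ≤ l.1 ∧ l.1 ≤ 1)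
    (hsort : (List.map (fun l : ℝ × ℝ => l.1) L).Pairwise (fun u v => v ≤ u)) :
    σS[L] ≤ (EFS[L, 0]).2 + ((L.length : ℝ) - 1) * (EFS[L, 0]).1 := by
  induction L with
  | nil => simp
  | cons l L ih =>
    have hl := hL l (by simp)
    have hL' : ∀ l' ∈ L, 0 ≤ l'.2 ∧ l'.2 ≤ 1 ∧ 0 ≤ l'.1 ∧ l'.1 ≤ 1 := fun l' hl' => hL l' (by simp [hl'])
    rw [List.map_cons, List.pairwise_cons] at hsort
    have ih' := ih hL' hsort.2
    have hAF : (EFS[L, 0]).1 ≤ (EFS[L, 0]).2 :=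
      EFS_fst_le_snd L (fun l' hl' => ⟨(hL' l' hl').1, (hL' l' hl').2.1, (hL' l' hl').2.2.1⟩) hsort.2
    have hA0 : 0 ≤ (EFS[L, 0]).1 :=
      (EFS_lower (le_refl (0 : ℝ)) L (fun l' hl' => ⟨(hL' l' hl').1, (hL' l' hl').2.1, (hL' l' hl').2.2.1⟩)).1
    have hF1 : (EFS[L, 0]).2 ≤ 1 :=
      efs_snd_le_of_weights_le L zero_le_one (fun l' hl' => ⟨(hL' l' hl').1, (hL' l' hl').2.1, (hL' l' hl').2.2.2⟩)
    have hlen : (0 : ℝ) ≤ L.length := Nat.cast_nonneg _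
    have hF0 : 0 ≤ (EFS[L, 0]).2 := le_trans hA0 hAF
    set A := (EFS[L, 0]).1 with hA
    set F := (EFS[L, 0]).2 with hF
    -- the one-step inequality `F + (n − 1) A ≤ (1 − p) F + n (p F + (1 − p) A)`
    have key : F + ((L.length : ℝ) - 1) * A ≤ (1 - l.2) * F + (L.length : ℝ) * (l.2 * F + (1 - l.2) * A) := by
      rcases Nat.eq_zero_or_pos L.length with h0 | hpos
      · have hLnil : L = [] := List.length_eq_zero_iff.1 h0
        subst hLnil
        simp [hA, hF]
      · have hn1 : (1 : ℝ) ≤ L.length := by exact_mod_cast hpos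
        by_cases hnp : (L.length : ℝ) * l.2 ≤ 1
        · nlinarith [mul_nonneg (mul_nonneg hl.1 (sub_nonneg.2 hn1)) hF0, mul_nonneg hA0 (sub_nonneg.2 hnp)]
        · push Not at hnp
          nlinarith [mul_le_mul_of_nonneg_left hAF (mul_nonneg hl.1 (sub_nonneg.2 hn1)), mul_nonneg hA0 (sub_nonneg.2 hl.2.1)]
    rw [EFS_cons, σS_cons, List.length_cons]
    push_cast
    show l.1 * l.2 + σS[L] ≤ l.1 * l.2 + (1 - l.2) * F + ((L.length : ℝ) + 1 - 1) * (l.2 * F + (1 - l.2) * A)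
    have hring : ((L.length : ℝ) + 1 - 1) = (L.length : ℝ) := by ring
    rw [hring]
    linarith [ih', key]

/-- `|L|·x ≤ Σ w p` for admissible items. [this work] -/
theorem length_mul_le_sigma (L : List (ℝ × ℝ)) (hL : ∀ l ∈ L, Adm[x, l]) : (L.length : ℝ) * x ≤ σS[L] := by
  induction L with
  | nil => simp
  | cons l L ih =>
    have hl := hL l (by simp)
    have ih' := ih (fun l' hl' => hL l' (by simp [hl']))
    rw [σS_cons, List.length_cons]
    push_cast
    nlinarith [hl.2.2.2]

/-! ### The independent-relay case and the boosted chain lemma -/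

/-- **Independent relay** (`y = 0`): a distinguished relay of marginal `x` independent of admissible companions listed heaviest first:
`(1 − x)·E W₀ + x·E F₀ ≥ x·min(1, Σ w p)`. [this work] -/
theorem boost_base (hx : 0 < x) (L : List (ℝ × ℝ)) (hL : ∀ l ∈ L, Adm[x, l])
    (hsort : (List.map (fun l : ℝ × ℝ => l.1) L).Pairwise (fun u v => v ≤ u)) :
    x * min 1 σS[L] ≤ (1 - x) * (EFS[L, 0]).1 + x * (EFS[L, 0]).2 := by
  -- the empty list
  by_cases hne : L = []
  · subst hne; simp
  -- bookkeeping for the items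
  have hB : ∀ l ∈ L, 0 ≤ l.2 ∧ l.2 ≤ 1 ∧ 0 ≤ l.1 ∧ l.1 ≤ 1 := by
    intro l hl
    have h := hL l hl
    exact ⟨h.1, h.2.1, le_of_lt (adm_bounds hx h).1, h.2.2.1⟩
  have hx1 : x ≤ 1 := by
    obtain ⟨l, hl⟩ := List.exists_mem_of_ne_nil L hne
    have h := hL l hl
    have hb := adm_bounds hx h
    nlinarith [h.2.1, h.2.2.1, hb.1]
  set A := (EFS[L, 0]).1 with hA
  set F := (EFS[L, 0]).2 with hF
  have hA0 : 0 ≤ A := (EFS_lower (le_refl (0 : ℝ)) L (fun l hl => ⟨(hB l hl).1, (hB l hl).2.1, (hB l hl).2.2.1⟩)).1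
  have hAF : A ≤ F := EFS_fst_le_snd L (fun l hl => ⟨(hB l hl).1, (hB l hl).2.1, (hB l hl).2.2.1⟩) hsort
  have hF1 : F ≤ 1 := efs_snd_le_of_weights_le L zero_le_one (fun l hl => ⟨(hB l hl).1, (hB l hl).2.1, (hB l hl).2.2.2⟩)
  have hsm : F - A ≤ σS[L] := efs_one_le_sigma L (fun l hl => ⟨(hB l hl).1, (hB l hl).2.1, (hB l hl).2.2.1⟩)
  have hm : σS[L] ≤ F + ((L.length : ℝ) - 1) * A := sigma_le_efs L hB hsort
  have hnx : (L.length : ℝ) * x ≤ σS[L] := length_mul_le_sigma L hL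
  have hn : 1 ≤ L.length := List.length_pos_of_ne_nil hne
  -- one admissible level: `z = 1 − F`, `s = F − A`, `t = A`, values `A ↦ 0`, `B ↦ x`, `C ↦ 1`, `w = 1`, `m = σS`
  have key := level_reduce x 1 (1 - F) (F - A) A σS[L] 0 x 1 L.length hx hn (by linarith) (by linarith) hA0 (by ring) hsm
    (by linarith) (by linarith) (le_refl _) zero_le_one (le_refl _) (le_refl _) hx1
  have hval : (1 - F) * 0 + (F - A) * x + A * 1 = (1 - x) * A + x * F := by ring
  rw [hval] at key
  rcases key with h1 | ⟨hm1, h2⟩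
  · have : x * min 1 σS[L] ≤ x := by nlinarith [min_le_left (1 : ℝ) σS[L]]
    linarith
  · have : x * min 1 σS[L] ≤ σS[L] * x := by nlinarith [min_le_right (1 : ℝ) σS[L]]
    linarith

/-- **THE BOOSTED CHAIN LEMMA.**  Items admissible at `x > 0` listed heaviest first; the distinguished relay is reached through the
chain with probability `y ∈ [0, x]` and through an independent second route so that its marginal is `x`.  Then
`(1 − y)·x·min(1, Σ w p) ≤ (1 − x)·(EFS[L, y]).1 + (x − y)·(EFS[L, 0]).2`, i.e. `(1 − b)·E W_y + b·E F₀ ≥ x·min(1, σ)` with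
`b = (x − y)/(1 − y)`.  [this work] -/
theorem secondWeight_boost (hx : 0 < x) (L : List (ℝ × ℝ)) (hL : ∀ l ∈ L, Adm[x, l])
    (hsort : (List.map (fun l : ℝ × ℝ => l.1) L).Pairwise (fun u v => v ≤ u)) {y : ℝ} (hy0 : 0 ≤ y) (hyx : y ≤ x) :
    (1 - y) * (x * min 1 σS[L]) ≤ (1 - x) * (EFS[L, y]).1 + (x - y) * (EFS[L, 0]).2 := by
  -- no companion: both sides vanish
  by_cases hne : L = []
  · subst hne; simp
  have hx1 : 0 ≤ 1 - x := by
    obtain ⟨l, hl⟩ := List.exists_mem_of_ne_nil L hne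
    have h := hL l hl
    have hb := adm_bounds hx h
    nlinarith [h.2.1, h.2.2.1, hb.1]
  obtain ⟨S, Z, hS, hZ, haff⟩ := EFS_affine_base L (fun l hl => ⟨(hL l hl).1, (hL l hl).2.1⟩)
  have hyS : (EFS[L, y]).1 = (EFS[L, 0]).1 + y * S := by rw [haff y]
  have hxS : (EFS[L, x]).1 = (EFS[L, 0]).1 + x * S := by rw [haff x]
  -- endpoint `y = x`: the chain lemma
  have hP1 : x * min 1 σS[L] ≤ (EFS[L, 0]).1 + x * S := by rw [← hxS]; exact secondWeight_singles hx L hL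
  -- endpoint `y = 0`: the independent relay
  have hP2 : x * min 1 σS[L] ≤ (1 - x) * (EFS[L, 0]).1 + x * (EFS[L, 0]).2 := boost_base hx L hL hsort
  rw [hyS]
  -- affine interpolation: `x·g(y) = (x − y)·g(0) + y·g(x)`
  have hxy : 0 ≤ x - y := by linarith
  nlinarith [mul_le_mul_of_nonneg_left hP2 hxy, mul_le_mul_of_nonneg_left hP1 (mul_nonneg hy0 hx1), hx]

end SecondWeight

end Quant

end Summit.CriticalPhenomena.PercolationContinuityZ3.Theorems
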